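import Summits.QuantumFields.YangMills.Theorems.BalabanUVNodesN12TowerGuardsOfClass
import Literature.MathematicalPhysics.QuantumFieldTheory.Balaban1983to89.B15Claim189CubePin

/-!
# DAG node N12 [B15] — THE TOWER BOX OF A POSITIVE-LEVEL CONSTRAINED BOND OF `𝐁_k(Z)` LIES INSIDE `Z` (all four corners of each of its plaquettes), HENCE THE PULL-BACK DATUM'S TOWER
# GUARDS FROM SCALE-`k` REGULARITY OF `Ṽ_k` ON `Z` — the geometry row `hbox` of `N12TowerGuardsOfClass.guardOn_towerRegion_qsstarGIter0_of_plaqSmallOn` DISCHARGED at the record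

[Balaban1988Convergent] = «[III]», (2.2) p. 255, (2.13) pp. 256–257 («dist(Ω_n, Ωᶜ_{n−1}) ≧ LⁿξM₁»); [Balaban1989LargeFieldI] = «[IV]», (1.74) p. 192, p. 193 ll. 14–20;
[BalabanImbrieJaffe1985] (4.5.3) p. 312; [Balaban1987RG1] (0.1) p. 251, (0.4) p. 253.

Cell `pub-ymgap`, HUMAN RULINGS D-0062 ∕ D-0149, lane owner `pub-ymgap-dag-n12-c` (g24).  Key K1⁹ `stmt-QuantumFields-27364`, `--kind proof --supports … --as helper`; count-neutral.
NEW leaf; CONSUMED BY NAME, nothing modified: dag-n12-w6's `N12WindowNearRegionGeometry` (`exists_word_endpoints`, `walkEnd_eq_cover_and_within`) ∕ `N12GaugeLetterLocOfClass.exists_cover_of_mem_boxPlaqs`,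
r12's `B14.Eq213DetSet.dist_maxDomT` ∕ `maxDomT_subset`, n28's `B15Claim189CubePin.cover_add_single`, this lane's `N12TowerGuardsOfClass` (step (r2)).

WHY.  Step (r2)'s datum supplier `guardOn_towerRegion_qsstarGIter0_of_plaqSmallOn` displays ONE geometry row `hbox`: the fine plaquettes of the tower box of the constrained bond have all four
corners in a union of `k`-blocks `Y` on whose scale-`k` plaquettes the datum `V` is small.  At the record `Y = Z` ((Gᵃ) `hZblk : IsBlockUnion k Z`; `Ṽ_k = ext V_k` is regular on
`plaqsInside (pts k Z)` by `B15ShellGauge193Local.dist1_plaqHol_extend_shellGauge_le`), and the row HOLDS: a level-`j` constrained bond (`1 ≤ j ≤ k`) has an end in `Γ_j ⊆ Ω_j(Z)^{(j)}`; its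
tower box (half-width `3Lʲ − 3` (+2) about `ι_j c₋`, itself within `Lʲ` of that end) lies within `4Lʲ` of a point of `Ω_j(Z)`, and print's collar `dist(Ω_j, Ω_{j−1}ᶜ) ≥ LʲM₁` (`dist_maxDomT`,
`4L ≤ M₁`) puts every corner of every box plaquette in `Ω_{j−1}(Z) ⊆ Z`.

CONTENTS (namespace `Summit.QuantumFields.YangMills.BalabanUVNodes.N12TowerBoxInsideZ`; theorems only — no `def`, no `instance`, no `sorry`).
* §1 `within_one_self` · `within_one_add_single` · `within_one_add_single_add_single` (cover bookkeeping of the four corners).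
* §2 ★★ `towerBoxPlaqs_subset_maxDomT_pred` (every corner in `Ω_{j−1}(Z)`) · ★★★ `towerBoxPlaqs_subset_plaqsInside` (the row `hbox` at `Y = Z`).
* §3 ★★★ `guardOn_towerRegion_qsstarGIter0_of_plaqSmallOn_Z` (the pull-back datum `Q_k^{s*}V` is (0.4)-guarded along the tower of every positive-level constrained bond of `𝐁_k(Z)`, from
  `IsBlockUnion k Z`, `PlaqSmallOn (plaqsInside (pts k Z)) δ V`, the radius letter and the budget `(d−1)(6Lʲ−4)·δ ≤ ρ″`) · ★★★ `guardOn_towerRegion_Bj_qsstarGIter0_of_plaqSmallOn_Z`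
  (enumerated over `constrEnum (𝐁_k(Z)) k`, level `0` vacuous; budget in the `j`-free form `6(d−1)Lᵏ·δ ≤ ρ″`) — the replacement text for the w1 lineage's `hsbQ`, INHABITED at the record.

HONEST FRAMING ∕ LOCATED.  Lattice∕cover bookkeeping over landed modules; the radius `ρ″` remains an ∃-constant per height (letter `hsbU`), the budget a volume-free smallness floor; nothing of
Bałaban's asserted; count-neutral helper; N12 NOT discharged; K1⁹ NOT closed; counts unmoved; one finite 𝕋⁴ programme at fixed ε — R4 closes the conditional finite-𝕋⁴ rung
`BalabanLadder.UV` only; NOT continuum ∕ OS ∕ mass gap ∕ Clay.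
-/

noncomputable section

open scoped BigOperators Matrix.Norms.L2Operator Topology

namespace Summit.QuantumFields.YangMills.BalabanUVNodes.N12TowerBoxInsideZ

open Literature.MathematicalPhysics.QuantumFieldTheory.Balaban1983to89
open T4Continuum (T4Family walkEnd Letter netDisp wordRev walkEnd_walkEnd_wordRev)
open BlockAveraging (Small blockAvg)
open B15DeterminingSets
open B14.Eq213MaximalDomains (side)
open B14.Eq213DetSet (Bj Bj_mid Bj_top maxDomT maxDomT_subset dist_maxDomT)
open B14.Eq22Determines (blockIter IsBlockUnion)
open B14DomainGeom (Within Pt)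
open B15Eq112TorusCover (cover lift cover_lift)
open B15Claim189CubePin (cover_add_single)
open B10Eq42TorusConstraint (bondsIn)
open B15Prop1Carrier (plaqsInside)
open ExpMeanLog (expMeanLogSU)
open T4AxialGaugeSmallField (boxPlaqs)
open T4ReflectionCone (three_le_L)
open Node00 (Stage7Numerics SU coeField SmallBelow avOfRecord constrCard constrEnum)
open Literature.MathematicalPhysics.QuantumFieldTheory.BalabanImbrieJaffe1984to88.BIJ85Eq453GaugeField (qsstarGIter0)
open Summit.QuantumFields.YangMills.BalabanUVNodes.N12GaugeLetterLocOfClass (exists_cover_of_mem_boxPlaqs)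
open Summit.QuantumFields.YangMills.BalabanUVNodes.N12WindowNearRegionGeometry (exists_word_endpoints walkEnd_eq_cover_and_within)
open Summit.QuantumFields.YangMills.BalabanUVNodes.N12TowerGuardsOfClass (guardOn_towerRegion_qsstarGIter0_of_plaqSmallOn)
open B15AveragingHolomorphicTowerRegion (guardOn_towerRegion_zero)

variable {F : T4Family} {N : ℕ} [NeZero N]

/-! ## §1  Cover bookkeeping: the four corners of a fine plaquette are within `1` of its base corner -/

/-- `Within 1 z z`. [folklore] -/
theorem within_one_self {d : ℕ} (z : Pt d) : Within 1 z z := fun i => by simp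

/-- `Within 1 z (z + e_μ)`. [folklore] -/
theorem within_one_add_single {d : ℕ} (z : Pt d) (μ : Fin d) : Within 1 z (z + Pi.single μ 1) := fun i => by
  by_cases h : i = μ
  · subst h; simp
  · simp [Pi.single_eq_of_ne h]

/-- `Within 1 z (z + e_μ + e_ν)` for `μ ≠ ν`. [folklore] -/
theorem within_one_add_single_add_single {d : ℕ} (z : Pt d) {μ ν : Fin d} (hμν : μ ≠ ν) : Within 1 z (z + Pi.single μ 1 + Pi.single ν 1) := fun i => by
  by_cases hμ : i = μ
  · subst hμ
    simp [Pi.single_eq_of_ne hμν]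
  · by_cases hν : i = ν
    · subst hν; simp [Pi.single_eq_of_ne hμ]
    · simp [Pi.single_eq_of_ne hμ, Pi.single_eq_of_ne hν]

/-! ## §2  The tower box of a positive-level constrained bond lies in `Ω_{j−1}(Z) ⊆ Z`, all four corners of each plaquette -/

/-- ★★ **EVERY CORNER OF EVERY PLAQUETTE OF THE TOWER BOX OF A POSITIVE-LEVEL CONSTRAINED BOND LIES IN `Ω_{j−1}(Z)`.**  For `1 ≤ j ≤ k`, `c ∈ bondsOf (𝐁_k(Z) j)` (an end `y` with
`ι_j y ∈ Ω_j(Z)`), `4L ≤ M₁` and the cube divisibility at level `k`: every plaquette `p` of the coordinate box of half-width `3Lʲ − 3` (+2) about `ι_j c₋` has a cover witness `z` of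
`p₋` (`π z = p₋`) every cover point `z′` within `1` of which projects into `Ω_{j−1}(Z)` — the word `ι_j y → ι_j c₋` has length `≤ Lʲ` (`exists_word_endpoints`), the box point is within `3Lʲ − 1` of `ι_j c₋`
(`exists_cover_of_mem_boxPlaqs`), so `z′` is within `4Lʲ ≤ LʲM₁ − 1` of a cover point over `Ω_j(Z)`, and print's collar applies (`dist_maxDomT`).
[cite: Balaban1988Convergent, (2.2) p.255, (2.13) pp.256–257; Balaban1987RG1, (0.1) p.251] -/
theorem towerBoxPlaqs_subset_maxDomT_pred (ν : Stage7Numerics) (Kt : ℕ) {k : ℕ} (Z : Set (Site (F.P Kt) 0))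
    (hM4 : 4 * (F.P Kt).L ≤ ν.M₁) (hdiv : side (F.P Kt).L ν.M₁ k ∣ (F.P Kt).sitesPerDir 0)
    {j : ℕ} (hj1 : 1 ≤ j) (hjk : j ≤ k) {c : PBond (F.P Kt) j} (hc : c ∈ bondsOf (Bj ν.M₁ Z k j))
    {p : Plaq (F.P Kt) 0}
    (hp : p ∈ (boxPlaqs (fun κ => (((embIter j c.src) κ).val : ℤ) - ((3 * (F.P Kt).L ^ j - 3 : ℕ) : ℤ))
      (fun κ => (((embIter j c.src) κ).val : ℤ) + ((3 * (F.P Kt).L ^ j - 3 : ℕ) : ℤ) + 2) : Set (Plaq (F.P Kt) 0))) :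
    ∃ z : Pt (F.P Kt).d, p.src = cover (F.P Kt) z ∧ ∀ z' : Pt (F.P Kt).d, Within 1 z z' → cover (F.P Kt) z' ∈ maxDomT ν.M₁ Z (j - 1) := by
  have hM1 : 1 ≤ ν.M₁ := le_trans (by have := three_le_L (F.P Kt); omega) hM4
  -- the end of `c` in `Γ_j ⊆ Ω_j^{(j)}`
  obtain ⟨y, hy, hyΩ⟩ : ∃ y : Site (F.P Kt) j, (y = c.src ∨ y = c.tgt) ∧ embIter j y ∈ maxDomT ν.M₁ Z j := by
    have hsub : Bj ν.M₁ Z k j ⊆ pts j (maxDomT ν.M₁ Z j) := by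
      rcases lt_or_eq_of_le hjk with hlt | rfl
      · rw [Bj_mid hj1 hlt]; exact fun _ h => h.1
      · rw [Bj_top]
    rcases hc with h | h
    · exact ⟨c.src, Or.inl rfl, mem_pts.1 (hsub h)⟩
    · exact ⟨c.tgt, Or.inr rfl, mem_pts.1 (hsub h)⟩
  -- the word from `ι_j y` to `ι_j c₋`, read backwards on the cover
  obtain ⟨w₀, hw₀len, hw₀⟩ := exists_word_endpoints c hy (Or.inl rfl : c.src = c.src ∨ c.src = c.tgt)
  obtain ⟨hx₀cov, hwx⟩ := walkEnd_eq_cover_and_within (embIter j c.src) (wordRev w₀)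
  have hback : walkEnd (embIter j c.src) (wordRev w₀) = embIter j y := by
    rw [← hw₀]; exact walkEnd_walkEnd_wordRev (embIter j y) w₀
  rw [hback] at hx₀cov
  have hlen : ((wordRev w₀).length : ℤ) ≤ (((F.P Kt).L ^ j : ℕ) : ℤ) := by
    have : (wordRev w₀).length = w₀.length := by simp [wordRev]
    rw [this]; exact_mod_cast hw₀len
  -- the box witness of `p₋`
  obtain ⟨z, hsrc, hwz⟩ := exists_cover_of_mem_boxPlaqs (embIter j c.src) (3 * (F.P Kt).L ^ j - 3) hp
  refine ⟨z, hsrc, fun z' hz' => ?_⟩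
  -- total displacement from the cover point over `Ω_j(Z)`: `Lʲ + (3Lʲ − 3 + 2) + 1 ≤ LʲM₁ − 1`
  have hwithin : Within ((((F.P Kt).L ^ j : ℕ) : ℤ) + ((((3 * (F.P Kt).L ^ j - 3 : ℕ) : ℕ) : ℤ) + 2) + 1)
      (fun μ => lift (F.P Kt) (embIter j c.src) μ + netDisp (wordRev w₀) μ) z' :=
    Within.triangle (Within.triangle (Within.mono hlen hwx.symm) hwz) hz'
  obtain ⟨i, rfl⟩ : ∃ i, j = i + 1 := ⟨j - 1, by omega⟩
  rw [Nat.add_sub_cancel]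
  refine dist_maxDomT hM1 hdiv (n := i) hjk (x := fun μ => lift (F.P Kt) (embIter (i + 1) c.src) μ + netDisp (wordRev w₀) μ)
    (by rw [← hx₀cov]; exact hyΩ) (Within.mono ?_ hwithin)
  -- the margin
  have hq : 1 ≤ (F.P Kt).L ^ (i + 1) := Nat.one_le_pow _ _ (F.P Kt).L_pos
  have hL3 : 3 ≤ (F.P Kt).L := three_le_L (F.P Kt)
  have h5 : 5 * (F.P Kt).L ^ (i + 1) ≤ (F.P Kt).L ^ (i + 1) * ν.M₁ := by
    calc 5 * (F.P Kt).L ^ (i + 1) ≤ ν.M₁ * (F.P Kt).L ^ (i + 1) := Nat.mul_le_mul_right _ (by omega)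
      _ = (F.P Kt).L ^ (i + 1) * ν.M₁ := by ring
  have hcast : ((((3 * (F.P Kt).L ^ (i + 1) - 3 : ℕ) : ℕ) : ℤ)) = 3 * (((F.P Kt).L ^ (i + 1) : ℕ) : ℤ) - 3 := by
    rw [Nat.cast_sub (by omega)]; push_cast; ring
  rw [hcast]
  unfold side
  have h5' : ((5 * (F.P Kt).L ^ (i + 1) : ℕ) : ℤ) ≤ (((F.P Kt).L ^ (i + 1) * ν.M₁ : ℕ) : ℤ) := by exact_mod_cast h5
  push_cast at h5' ⊢
  have hq' : (1 : ℤ) ≤ (((F.P Kt).L : ℤ)) ^ (i + 1) := by exact_mod_cast hq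
  linarith

/-- ★★★ **THE TOWER BOX OF A POSITIVE-LEVEL CONSTRAINED BOND OF `𝐁_k(Z)` LIES IN `plaqsInside Z`** — the geometry row `hbox` of `N12TowerGuardsOfClass.guardOn_towerRegion_qsstarGIter0_of_plaqSmallOn` at
`Y = Z`: all four corners of every plaquette of the box lie in `Ω_{j−1}(Z) ⊆ Z` (§2 with the four corners `z`, `z + e_μ`, `z + e_ν`, `z + e_μ + e_ν` of the box witness, `cover_add_single`).
[cite: Balaban1988Convergent, (2.2) p.255, (2.13) pp.256–257; Balaban1989LargeFieldI, (1.74) p.192, p.193 L14–16] -/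
theorem towerBoxPlaqs_subset_plaqsInside (ν : Stage7Numerics) (Kt : ℕ) {k : ℕ} (Z : Set (Site (F.P Kt) 0))
    (hM4 : 4 * (F.P Kt).L ≤ ν.M₁) (hdiv : side (F.P Kt).L ν.M₁ k ∣ (F.P Kt).sitesPerDir 0)
    {j : ℕ} (hj1 : 1 ≤ j) (hjk : j ≤ k) {c : PBond (F.P Kt) j} (hc : c ∈ bondsOf (Bj ν.M₁ Z k j)) :
    (boxPlaqs (fun κ => (((embIter j c.src) κ).val : ℤ) - ((3 * (F.P Kt).L ^ j - 3 : ℕ) : ℤ))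
      (fun κ => (((embIter j c.src) κ).val : ℤ) + ((3 * (F.P Kt).L ^ j - 3 : ℕ) : ℤ) + 2) : Set (Plaq (F.P Kt) 0)) ⊆ plaqsInside Z := by
  intro p hp
  have hM1 : 1 ≤ ν.M₁ := le_trans (by have := three_le_L (F.P Kt); omega) hM4
  obtain ⟨z, hsrc, hz⟩ := towerBoxPlaqs_subset_maxDomT_pred ν Kt Z hM4 hdiv hj1 hjk hc hp
  have key : ∀ z' : Pt (F.P Kt).d, Within 1 z z' → cover (F.P Kt) z' ∈ Z := fun z' hz' =>
    maxDomT_subset hM1 Z (j - 1) (hz z' hz')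
  have hne : p.μ ≠ p.ν := ne_of_lt p.hμν
  refine ⟨?_, ?_, ?_, ?_⟩
  · rw [hsrc]; exact key z (within_one_self z)
  · rw [hsrc, ← cover_add_single]; exact key _ (within_one_add_single z p.μ)
  · rw [hsrc, ← cover_add_single]; exact key _ (within_one_add_single z p.ν)
  · rw [hsrc, ← cover_add_single, ← cover_add_single]; exact key _ (within_one_add_single_add_single z hne)

/-! ## §3  The pull-back datum's tower guards at the constrained bonds of `𝐁_k(Z)`, from scale-`k` regularity of `V` on `Z` -/

/-- ★★★ **THE DATUM `Q_k^{s*}V` IS (0.4)-GUARDED ALONG THE TOWER OF EVERY POSITIVE-LEVEL CONSTRAINED BOND OF `𝐁_k(Z)`**, given: `Z` a union of `k`-blocks ((Gᵃ) `hZblk`), `V` `δ`-plaquette-small on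
`plaqsInside (pts k Z)` (`0 < δ`, `2 ≤ d`; at the record `V = ext V_k`, `δ = 12d(n+2)²ε` by `B15ShellGauge193Local.dist1_plaqHol_extend_shellGauge_le`), the height's radius letter `hsbU` and the
budget `(d−1)(6Lʲ−4)·δ ≤ ρ″` — step (r2)'s `guardOn_towerRegion_qsstarGIter0_of_plaqSmallOn` with its geometry row `hbox` DISCHARGED by §2.
[cite: Balaban1989LargeFieldI, (1.74) p.192, p.193 L14–16; BalabanImbrieJaffe1985, (4.5.3) p.312; Balaban1987RG1, (0.4) p.253, (0.21) p.256; Balaban1988Convergent, (2.2) p.255, (2.13) pp.256–257] -/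
theorem guardOn_towerRegion_qsstarGIter0_of_plaqSmallOn_Z (ν : Stage7Numerics) (Kt : ℕ) (hd : 2 ≤ (F.P Kt).d) {k : ℕ} (Z : Set (Site (F.P Kt) 0))
    (hkK : k + 1 ≤ (F.P Kt).m + (F.P Kt).K) (hM4 : 4 * (F.P Kt).L ≤ ν.M₁) (hdiv : side (F.P Kt).L ν.M₁ k ∣ (F.P Kt).sitesPerDir 0)
    (hZblk : IsBlockUnion k Z) {δ : ℝ} (hδ : 0 < δ) {V : GaugeField (F.P Kt) k (SU N)} (hV : PlaqSmallOn (plaqsInside (pts k Z)) δ V)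
    {ρ'' : ℝ} (hsbU : ∀ W : GaugeField (F.P Kt) 0 (SU N), ‖coeField W - 1‖ ≤ ρ'' → SmallBelow (avOfRecord F N Kt) k W)
    {j : ℕ} (hj1 : 1 ≤ j) (hjk : j ≤ k) (hbudget : ((((F.P Kt).d - 1 : ℕ)) : ℝ) * ((6 * (F.P Kt).L ^ j - 4 : ℕ) : ℕ) * δ ≤ ρ'')
    {c : PBond (F.P Kt) j} (hc : c ∈ bondsOf (Bj ν.M₁ Z k j)) :
    ∀ j', j' < j → ∀ c' : PBond (F.P Kt) (j' + 1), c' ∈ bondsIn (j' + 1) (blockIter j ⁻¹' ({c.src, c.tgt} : Set (Site (F.P Kt) j))) →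
      Small expMeanLogSU (Averaging.iter (avOfRecord F N Kt) j' (qsstarGIter0 k V)) c' :=
  guardOn_towerRegion_qsstarGIter0_of_plaqSmallOn Kt hd hkK hj1 hjk c hZblk (towerBoxPlaqs_subset_plaqsInside ν Kt Z hM4 hdiv hj1 hjk hc) hδ hV hsbU hbudget

/-- ★★★ **THE DATUM's TOWER GUARDS AT EVERY CONSTRAINED BOND OF `𝐁_k(Z)`, ENUMERATED** — the replacement text for the w1 lineage's global letter `hsbQ : SmallBelow k (Q_k^{s*}Ṽ_k)` (the `hgQ` row
of `B15Prop1MinimiserFamilyFromThm1AtBaseCentralTower.hMin_atRecord_of_node00Letters_thm1AtBase_central_of_guardOn` at `𝔹 = 𝐁_k(Z)`), INHABITED from scale-`k` regularity of `V` on `Z`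
(level `0`: vacuous; positive levels: above, with the `j`-free budget `6(d−1)Lᵏ·δ ≤ ρ″`). [cite: Balaban1989LargeFieldI, (1.74) p.192, p.193 L14–20; Balaban1988Convergent, (2.2) p.255, (2.10)–(2.13) pp.256–257; Balaban1987RG1, (0.4) p.253] -/
theorem guardOn_towerRegion_Bj_qsstarGIter0_of_plaqSmallOn_Z (ν : Stage7Numerics) (Kt : ℕ) (hd : 2 ≤ (F.P Kt).d) {k : ℕ} (Z : Set (Site (F.P Kt) 0))
    (hkK : k + 1 ≤ (F.P Kt).m + (F.P Kt).K) (hM4 : 4 * (F.P Kt).L ≤ ν.M₁) (hdiv : side (F.P Kt).L ν.M₁ k ∣ (F.P Kt).sitesPerDir 0)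
    (hZblk : IsBlockUnion k Z) {δ : ℝ} (hδ : 0 < δ) {V : GaugeField (F.P Kt) k (SU N)} (hV : PlaqSmallOn (plaqsInside (pts k Z)) δ V)
    {ρ'' : ℝ} (hsbU : ∀ W : GaugeField (F.P Kt) 0 (SU N), ‖coeField W - 1‖ ≤ ρ'' → SmallBelow (avOfRecord F N Kt) k W)
    (hbudget : 6 * ((((F.P Kt).d - 1 : ℕ)) : ℝ) * (F.P Kt).L ^ k * δ ≤ ρ'') :
    ∀ i : Fin (constrCard (Bj ν.M₁ Z k) k), ∀ j', j' < (((constrEnum (Bj ν.M₁ Z k) k).symm i).1 : ℕ) →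
      ∀ c' : PBond (F.P Kt) (j' + 1),
        c' ∈ bondsIn (j' + 1) (blockIter (((constrEnum (Bj ν.M₁ Z k) k).symm i).1 : ℕ)
          ⁻¹' ({((constrEnum (Bj ν.M₁ Z k) k).symm i).2.1.src, ((constrEnum (Bj ν.M₁ Z k) k).symm i).2.1.tgt} :
            Set (Site (F.P Kt) ((constrEnum (Bj ν.M₁ Z k) k).symm i).1))) →
          Small expMeanLogSU (Averaging.iter (avOfRecord F N Kt) j' (qsstarGIter0 k V)) c' := by
  intro i
  have key : ∀ j, j ≤ k → ∀ c : PBond (F.P Kt) j, c ∈ bondsOf (Bj ν.M₁ Z k j) →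
      ∀ j', j' < j → ∀ c' : PBond (F.P Kt) (j' + 1), c' ∈ bondsIn (j' + 1) (blockIter j ⁻¹' ({c.src, c.tgt} : Set (Site (F.P Kt) j))) →
        Small expMeanLogSU (Averaging.iter (avOfRecord F N Kt) j' (qsstarGIter0 k V)) c' := by
    intro j hj c hc
    rcases Nat.eq_zero_or_pos j with rfl | hj1
    · exact guardOn_towerRegion_zero c (qsstarGIter0 k V)
    · refine guardOn_towerRegion_qsstarGIter0_of_plaqSmallOn_Z ν Kt hd Z hkK hM4 hdiv hZblk hδ hV hsbU hj1 hj (le_trans ?_ hbudget) hc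
      -- `(d−1)(6Lʲ−4)·δ ≤ 6(d−1)Lᵏ·δ`
      have hpow : (((6 * (F.P Kt).L ^ j - 4 : ℕ) : ℕ) : ℝ) ≤ 6 * ((F.P Kt).L : ℝ) ^ k := by
        have h1 : (6 * (F.P Kt).L ^ j - 4 : ℕ) ≤ 6 * (F.P Kt).L ^ k :=
          le_trans (Nat.sub_le _ _) (Nat.mul_le_mul_left _ (Nat.pow_le_pow_right (F.P Kt).L_pos hj))
        exact_mod_cast h1
      have hd0 : (0 : ℝ) ≤ (((F.P Kt).d - 1 : ℕ) : ℝ) := by positivity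
      calc ((((F.P Kt).d - 1 : ℕ)) : ℝ) * ((6 * (F.P Kt).L ^ j - 4 : ℕ) : ℕ) * δ
          ≤ ((((F.P Kt).d - 1 : ℕ)) : ℝ) * (6 * ((F.P Kt).L : ℝ) ^ k) * δ := by gcongr
        _ = 6 * ((((F.P Kt).d - 1 : ℕ)) : ℝ) * (F.P Kt).L ^ k * δ := by ring
  exact key _ (Nat.le_of_lt_succ ((constrEnum (Bj ν.M₁ Z k) k).symm i).1.2) _ ((constrEnum (Bj ν.M₁ Z k) k).symm i).2.2

end Summit.QuantumFields.YangMills.BalabanUVNodes.N12TowerBoxInsideZ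

end
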